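import Mathlib
import Literature.Probability.Process.DoobMaximalIneq
import HarnessLib

/-!
# Durrett §4.4, Exercises 4.4.7 (the one-sided `L²` maximal inequality
# `P(max_{m ≤ n} X_m ≥ λ) ≤ EX_n² / (EX_n² + λ²)` for a martingale with `X_0 = 0`) and 4.4.8 (ii)
# (`a log b ≤ a log a + b/e ≤ a log⁺ a + b/e`)

[topic Probability/Process]

| Durrett 2019, §4.4 Exercise 4.4.7 (p. 215) | declaration | status |
|---|---|---|
| `X_n` martingale, `X_0 = 0`, `EX_n² < ∞` ⟹ `P(max_{1≤m≤n} X_m ≥ λ) ≤ EX_n²/(EX_n² + λ²)` | `Durrett2019_exercise_4_4_7` | proved |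
| proof step (the hint): `P(max_{m≤n} X_m ≥ λ) ≤ E(X_n + c)²/(λ + c)²` for `c ≥ 0` | `measureReal_max_ge_le_integral_add_sq_div` | proved |
| Exercise 4.4.8 (ii) (p. 216): `a log b ≤ a log a + b/e ≤ a log⁺ a + b/e` for `a, b > 0` | `Durrett2019_exercise_4_4_8_ii` | proved (part (i) and the `L log L` bound itself are not treated) |

Proof (Durrett's hint: "Use the fact that `(X_n + c)²` is a submartingale and optimize over `c`"):
`X + c` is a martingale, so `(X_m + c)²` is a nonnegative submartingale (the tree's
`MeasureTheory.Martingale.submartingale_sq`); on `{max_{m≤n} X_m ≥ λ}` one has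
`max_{m≤n} (X_m + c)² ≥ (λ + c)²` (`λ > 0`, `c ≥ 0`), so Doob's inequality (Theorem 4.4.2,
Mathlib's `MeasureTheory.maximal_ineq`) gives `(λ + c)² P(max X_m ≥ λ) ≤ E(X_n + c)² = EX_n² + c²`
(`EX_n = EX_0 = 0`); the choice `c = EX_n²/λ` yields the claim.  The maximum is taken over
`0 ≤ m ≤ n` (Mathlib's `(range (n+1)).sup'`), which is Durrett's `1 ≤ m ≤ n` since `X_0 = 0 < λ`.

## References
* [Durrett2019] R. Durrett, *Probability: Theory and Examples*, 5th ed., Cambridge Series in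
  Statistical and Probabilistic Mathematics 49, Cambridge University Press (2019): §4.4 (Doob's
  inequality), Theorem 4.4.2, p. 213, Exercise 4.4.7, p. 215, and Exercise 4.4.8, p. 216.
-/

namespace Literature.Probability.Process

open _root_.MeasureTheory _root_.ProbabilityTheory Filter
open scoped ENNReal NNReal Topology

variable {Ω : Type*} {m₀ : MeasurableSpace Ω} {μ : Measure Ω} {ℱ : Filtration ℕ m₀}

/-- **The hint of Exercise 4.4.7.** For a square integrable martingale `X`, `λ > 0` and `c ≥ 0`:
`P(max_{m≤n} X_m ≥ λ) ≤ E(X_n + c)²/(λ + c)²` — Doob's inequality for the nonnegative submartingale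
`(X_m + c)²`. [cite: Durrett2019, §4.4 Exercise 4.4.7, p. 215 (proof step)] -/
theorem measureReal_max_ge_le_integral_add_sq_div [IsFiniteMeasure μ] {X : ℕ → Ω → ℝ}
    (hX : Martingale X ℱ μ) (hL2 : ∀ n, MemLp (X n) 2 μ) {l c : ℝ} (hl : 0 < l) (hc : 0 ≤ c)
    (n : ℕ) :
    μ.real {ω | l ≤ (Finset.range (n + 1)).sup' Finset.nonempty_range_add_one fun m => X m ω} ≤
      (∫ ω, (X n ω + c) ^ 2 ∂μ) / (l + c) ^ 2 := by
  have hXc : Martingale (fun m ω => X m ω + c) ℱ μ := hX.add (martingale_const ℱ μ c)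
  have hL2c : ∀ m, MemLp (fun ω => X m ω + c) 2 μ := fun m => (hL2 m).add (memLp_const c)
  have hY : Submartingale (fun m ω => (X m ω + c) ^ 2) ℱ μ := hXc.submartingale_sq hL2c
  have hYnn : 0 ≤ fun m ω => (X m ω + c) ^ 2 := fun m ω => sq_nonneg _
  set ε : ℝ≥0 := ⟨(l + c) ^ 2, sq_nonneg _⟩ with hε
  have hmax := maximal_ineq hY hYnn (ε := ε) n
  set B := {ω | ((ε : ℝ≥0) : ℝ) ≤ (Finset.range (n + 1)).sup' Finset.nonempty_range_add_one
    fun m => (X m ω + c) ^ 2} with hB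
  have hAB : {ω | l ≤ (Finset.range (n + 1)).sup' Finset.nonempty_range_add_one fun m => X m ω}
      ⊆ B := by
    intro ω hω
    simp only [hB, Set.mem_setOf_eq, Finset.le_sup'_iff] at hω ⊢
    obtain ⟨m, hm, hmx⟩ := hω
    refine ⟨m, hm, ?_⟩
    show (l + c) ^ 2 ≤ (X m ω + c) ^ 2
    exact pow_le_pow_left₀ (by linarith) (by linarith) 2
  have hI : ∫ ω in B, (X n ω + c) ^ 2 ∂μ ≤ ∫ ω, (X n ω + c) ^ 2 ∂μ :=
    setIntegral_le_integral (hL2c n).integrable_sq (ae_of_all _ fun ω => sq_nonneg _)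
  have h1 : (ε : ℝ≥0∞) * μ B ≤ ENNReal.ofReal (∫ ω, (X n ω + c) ^ 2 ∂μ) :=
    hmax.trans (ENNReal.ofReal_le_ofReal hI)
  have hεpos : (0 : ℝ) < (l + c) ^ 2 := by positivity
  have h2 : (l + c) ^ 2 * μ.real B ≤ ∫ ω, (X n ω + c) ^ 2 ∂μ := by
    have h := ENNReal.toReal_mono ENNReal.ofReal_ne_top h1
    rw [ENNReal.toReal_mul, ENNReal.toReal_ofReal (integral_nonneg fun ω => sq_nonneg _),
      ENNReal.coe_toReal] at h
    exact h
  calc μ.real {ω | l ≤ (Finset.range (n + 1)).sup' Finset.nonempty_range_add_one fun m => X m ω}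
      ≤ μ.real B := measureReal_mono hAB
    _ ≤ (∫ ω, (X n ω + c) ^ 2 ∂μ) / (l + c) ^ 2 := by
        rw [le_div_iff₀ hεpos, mul_comm]
        exact h2

/-- **Durrett, Exercise 4.4.7** (an extension of Theorem 4.4.2 to `p = 1`).  Let `X_n` be a
martingale with `X_0 = 0` and `EX_n² < ∞`.  Then
`P(max_{1≤m≤n} X_m ≥ λ) ≤ EX_n² / (EX_n² + λ²)` (`λ > 0`; the maximum over `0 ≤ m ≤ n` is the same
event since `X_0 = 0`).  Hint followed: `(X_n + c)²` is a submartingale; optimize over `c`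
(`c = EX_n²/λ`). [cite: Durrett2019, §4.4 Exercise 4.4.7, p. 215] -/
theorem Durrett2019_exercise_4_4_7 [IsProbabilityMeasure μ] {X : ℕ → Ω → ℝ} (hX : Martingale X ℱ μ)
    (hX0 : X 0 =ᵐ[μ] 0) (hL2 : ∀ n, MemLp (X n) 2 μ) {l : ℝ} (hl : 0 < l) (n : ℕ) :
    μ.real {ω | l ≤ (Finset.range (n + 1)).sup' Finset.nonempty_range_add_one fun m => X m ω} ≤
      (∫ ω, X n ω ^ 2 ∂μ) / (∫ ω, X n ω ^ 2 ∂μ + l ^ 2) := by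
  have hs0 : 0 ≤ ∫ ω, X n ω ^ 2 ∂μ := integral_nonneg fun ω => sq_nonneg _
  have hmean : ∫ ω, X n ω ∂μ = 0 := by
    have h := hX.setIntegral_eq (Nat.zero_le n) (MeasurableSet.univ : MeasurableSet[ℱ 0] Set.univ)
    simp only [Measure.restrict_univ] at h
    rw [← h, integral_congr_ae hX0]
    simp
  have hexp : ∀ c : ℝ, ∫ ω, (X n ω + c) ^ 2 ∂μ = ∫ ω, X n ω ^ 2 ∂μ + c ^ 2 := by
    intro c
    have e : ∀ ω, (X n ω + c) ^ 2 = (X n ω ^ 2 + 2 * c * X n ω) + c ^ 2 := fun ω => by ring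
    have i2 : Integrable (fun ω => 2 * c * X n ω) μ :=
      ((hL2 n).integrable one_le_two).const_mul _
    have i1 : Integrable (fun ω => X n ω ^ 2 + 2 * c * X n ω) μ := (hL2 n).integrable_sq.add i2
    simp_rw [e]
    rw [integral_add i1 (integrable_const _), integral_add (hL2 n).integrable_sq i2,
      integral_const_mul, hmean, integral_const, probReal_univ]
    simp
  have hb := measureReal_max_ge_le_integral_add_sq_div hX hL2 hl
    (div_nonneg hs0 hl.le : 0 ≤ (∫ ω, X n ω ^ 2 ∂μ) / l) n
  rw [hexp] at hb
  have hid : (∫ ω, X n ω ^ 2 ∂μ + ((∫ ω, X n ω ^ 2 ∂μ) / l) ^ 2) /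
      (l + (∫ ω, X n ω ^ 2 ∂μ) / l) ^ 2 = (∫ ω, X n ω ^ 2 ∂μ) / (∫ ω, X n ω ^ 2 ∂μ + l ^ 2) := by
    have hl0 : l ≠ 0 := hl.ne'
    have hd : (∫ ω, X n ω ^ 2 ∂μ) + l ^ 2 ≠ 0 := by positivity
    field_simp
    ring
  rw [hid] at hb
  exact hb

/-- **Durrett, Exercise 4.4.8 (ii)** (the calculus step of the `L log L` maximal inequality):
for `a, b > 0`, `a log b ≤ a log a + b/e ≤ a log⁺ a + b/e` (`log⁺ = max(log, 0)`, Mathlib's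
`Real.posLog`).  Indeed `a log b − a log a = a log(b/a) ≤ a · (b/a)/e` since `log x ≤ x/e`.
[cite: Durrett2019, §4.4 Exercise 4.4.8 (ii), p. 216] -/
theorem Durrett2019_exercise_4_4_8_ii {a b : ℝ} (ha : 0 < a) (hb : 0 < b) :
    a * Real.log b ≤ a * Real.log a + b / Real.exp 1 ∧
      a * Real.log a + b / Real.exp 1 ≤ a * Real.posLog a + b / Real.exp 1 := by
  constructor
  · -- `log x ≤ x / e` for `x > 0`, applied to `x = b / a`
    have hlog : ∀ x : ℝ, 0 < x → Real.log x ≤ x / Real.exp 1 := by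
      intro x hx
      have h := Real.log_le_sub_one_of_pos (div_pos hx (Real.exp_pos 1))
      rw [Real.log_div hx.ne' (Real.exp_pos 1).ne', Real.log_exp] at h
      linarith
    have h1 : Real.log b = Real.log a + Real.log (b / a) := by
      rw [Real.log_div hb.ne' ha.ne']
      ring
    have h2 := mul_le_mul_of_nonneg_left (hlog (b / a) (div_pos hb ha)) ha.le
    have h3 : a * (b / a / Real.exp 1) = b / Real.exp 1 := by
      field_simp
    rw [h1, mul_add]
    linarith
  · have h : Real.log a ≤ Real.posLog a := by
      rw [Real.posLog_apply]
      exact le_max_right _ _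
    nlinarith [mul_le_mul_of_nonneg_left h ha.le]

end Literature.Probability.Process
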